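import Mathlib
import Summits.Ventures.PercRepro.TriangleCapUpperZoneArith
import Summits.Ventures.PercRepro.TriangleCapStarFamilyNecessityUpper

/-!
# PercRepro — THE UPPER REGIME ONE BELOW ITS THRESHOLD: FEWER THAN `ρ` INSIDE EDGES (p3, gen 57; part 335)

`D + 1 ≤ 2 r`, `ρ = D − r ≥ 2`, `X = D − 2 ρ ≥ 1`, `m = D + r − 3`, `t = m D + r`.  With `1 ≤ I ≤ ρ − 1` inside edges
the columns sum to `t + I ≡ r + I (mod D)` (`1 ≤ r + I ≤ D − 1`) and the rows to `t − I = m D + (r − I)`.  An inside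
edge `x x'` has `c(x) + c(x') ≤ D + (r + I) − 1` — then the column loss at the residue `r + I` (part 328) costs
`2 (r + I) − 2` — or `c(x) + c(x') ≥ D + r + I`, whence its disjoint rows number `≥ D + r + I − (I + 1) = m + 2`
and the row cost with `m + 2` active rows (part 334) is `≥ φ_D(r − I) + 2 (r − I − 1)`.  Either way
`t (t − 1) + 2 ρ (X + 1) + (2 X − 2) + 2 (ρ − I)(ρ + I) ≤ 2 j + 2 t (D − 1)` (`upper_zone_I_lt`): the target
`2 ρ (X + 1) + 2 X − 2` of parts 336–337 with the surplus `2 (ρ − I)(ρ + I) ≥ 2 (2 ρ − 1)`.  Axioms: standard.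
-/

namespace PercRepro

namespace TriangleCap

namespace C047

open Finset

variable {V : Type*} [Fintype V] [DecidableEq V]

/-- The column-loss branch: `2 ρ (X + 1) + (2 X − 2) + 2 (ρ − I)(ρ + I) ≤ 2 I + ((r + I)(D − (r + I)) + (2 (r + I) − 2))
+ (r − I)(D − (r − I))` for `1 ≤ I ≤ ρ − 1` (the slack is `4 I`). -/
theorem below_arith_A (D r I : ℕ) (h1 : D + 1 ≤ 2 * r) (h2 : r + 2 ≤ D) (hI1 : 1 ≤ I) (hIρ : I + 1 ≤ D - r) :
    2 * ((D - r) * (D - 2 * (D - r) + 1)) + (2 * (D - 2 * (D - r)) - 2) + 2 * ((D - r - I) * (D - r + I)) ≤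
      2 * I + ((r + I) * (D - (r + I)) + (2 * (r + I) - 2)) + (r - I) * (D - (r - I)) := by
  obtain ⟨ρ, rfl⟩ : ∃ ρ, D = r + ρ := ⟨D - r, by omega⟩
  obtain ⟨X, rfl⟩ : ∃ X, r = ρ + X := ⟨r - ρ, by omega⟩
  have e1 : ρ + X + ρ - (ρ + X) = ρ := by omega
  rw [e1]
  obtain ⟨k, rfl⟩ : ∃ k, ρ = I + 1 + k := ⟨ρ - I - 1, by omega⟩
  obtain ⟨X', rfl⟩ : ∃ X', X = X' + 1 := ⟨X - 1, by omega⟩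
  have e2 : I + 1 + k + (X' + 1) + (I + 1 + k) - 2 * (I + 1 + k) + 1 = X' + 2 := by omega
  have e3 : I + 1 + k + (X' + 1) + (I + 1 + k) - 2 * (I + 1 + k) = X' + 1 := by omega
  have e4 : 2 * (X' + 1) - 2 = 2 * X' := by omega
  have e5 : I + 1 + k - I = k + 1 := by omega
  have e6 : I + 1 + k + (X' + 1) + (I + 1 + k) - (I + 1 + k + (X' + 1) + I) = k + 1 := by omega
  have e7 : 2 * (I + 1 + k + (X' + 1) + I) - 2 = 2 * (2 * I + k + X' + 1) := by omega
  have e8 : I + 1 + k + (X' + 1) - I = k + X' + 2 := by omega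
  have e9 : I + 1 + k + (X' + 1) + (I + 1 + k) - (k + X' + 2) = 2 * I + k + 1 := by omega
  rw [e2, e3, e4, e5, e6, e7, e8, e9]
  nlinarith [Nat.zero_le (I * k), Nat.zero_le (I * X'), Nat.zero_le (k * X')]

/-- The row branch: `2 ρ (X + 1) + (2 X − 2) + 2 (ρ − I)(ρ + I) ≤ 2 I + (r + I)(D − (r + I)) + ((r − I)(D − (r − I)) +
2 (r − I − 1))` for `1 ≤ I ≤ ρ − 1` (an identity). -/
theorem below_arith_B (D r I : ℕ) (h1 : D + 1 ≤ 2 * r) (h2 : r + 2 ≤ D) (hI1 : 1 ≤ I) (hIρ : I + 1 ≤ D - r) :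
    2 * ((D - r) * (D - 2 * (D - r) + 1)) + (2 * (D - 2 * (D - r)) - 2) + 2 * ((D - r - I) * (D - r + I)) ≤
      2 * I + (r + I) * (D - (r + I)) + ((r - I) * (D - (r - I)) + 2 * (r - I - 1)) := by
  obtain ⟨ρ, rfl⟩ : ∃ ρ, D = r + ρ := ⟨D - r, by omega⟩
  obtain ⟨X, rfl⟩ : ∃ X, r = ρ + X := ⟨r - ρ, by omega⟩
  have e1 : ρ + X + ρ - (ρ + X) = ρ := by omega
  rw [e1]
  obtain ⟨k, rfl⟩ : ∃ k, ρ = I + 1 + k := ⟨ρ - I - 1, by omega⟩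
  obtain ⟨X', rfl⟩ : ∃ X', X = X' + 1 := ⟨X - 1, by omega⟩
  have e2 : I + 1 + k + (X' + 1) + (I + 1 + k) - 2 * (I + 1 + k) + 1 = X' + 2 := by omega
  have e3 : I + 1 + k + (X' + 1) + (I + 1 + k) - 2 * (I + 1 + k) = X' + 1 := by omega
  have e4 : 2 * (X' + 1) - 2 = 2 * X' := by omega
  have e5 : I + 1 + k - I = k + 1 := by omega
  have e6 : I + 1 + k + (X' + 1) + (I + 1 + k) - (I + 1 + k + (X' + 1) + I) = k + 1 := by omega
  have e8 : I + 1 + k + (X' + 1) - I = k + X' + 2 := by omega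
  have e9 : I + 1 + k + (X' + 1) + (I + 1 + k) - (k + X' + 2) = 2 * I + k + 1 := by omega
  have e10 : k + X' + 2 - 1 = k + X' + 1 := by omega
  rw [e2, e3, e4, e5, e6, e8, e9, e10]
  nlinarith [Nat.zero_le (I * k), Nat.zero_le (I * X'), Nat.zero_le (k * X')]

/-- **FEWER THAN `ρ` INSIDE EDGES:** for `D + 1 ≤ 2 r`, `r + 2 ≤ D`, `m + 3 = D + r`, `t = m D + r`, every
triangle-free `H` with `s` edges, `w` of degree `s − t ≥ 1`, every off-degree `≤ D`, at the band value `2 j` with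
`1 ≤ I ≤ D − r − 1` inside edges has
`t (t − 1) + 2 ρ (D − 2 ρ + 1) + (2 (D − 2 ρ) − 2) + 2 (ρ − I)(ρ + I) ≤ 2 j + 2 t (D − 1)`, `ρ = D − r`. -/
theorem upper_zone_I_lt (H : SimpleGraph V) [DecidableRel H.Adj] (hfree : H.CliqueFree 3) (s m r D j : ℕ)
    (h1 : D + 1 ≤ 2 * r) (h2 : r + 2 ≤ D) (hm : m + 3 = D + r) (hs : H.edgeFinset.card = s) (w : V)
    (hw : deg H w + (m * D + r) = s) (hw1 : 1 ≤ deg H w)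
    (hj : ∑ v, deg H v * deg H v + 2 * ((m * D + r) * (s - (m * D + r) - 1)) + 2 * j = s * (s + 1))
    (hD : ∀ v, offDeg H w v ≤ D) (hI1 : 1 ≤ (insideEdges H w).card)
    (hIρ : (insideEdges H w).card + 1 ≤ D - r) :
    (m * D + r) * (m * D + r - 1) + 2 * ((D - r) * (D - 2 * (D - r) + 1)) + (2 * (D - 2 * (D - r)) - 2) +
        2 * ((D - r - (insideEdges H w).card) * (D - r + (insideEdges H w).card)) ≤
      2 * j + 2 * ((m * D + r) * (D - 1)) := by
  set t := m * D + r with ht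
  set I := (insideEdges H w).card with hIdef
  have hD0 : 0 < D := by omega
  have hD3 : 3 ≤ D := by omega
  have hdef := deficiency_identity_split H hfree s t j D hs w hw hw1 hj hD
  have hoff : (offEdges H w).card = t := by
    have := card_offEdges_add_deg H w
    omega
  have hatt := attach_add_card_inside H hfree w
  rw [hoff] at hatt
  have hsumcol := sum_offDeg_nonNbrs_eq_add_card_inside H hfree w
  rw [hoff] at hsumcol
  have hsumrow : ∑ y ∈ univ.filter (fun y => H.Adj w y), offDeg H w y = t - I := by
    unfold attach at hatt
    omega
  have hcol := sum_mul_sub_ge_phi (nonNbrs H w) (offDeg H w) D (fun x _ => hD x)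
  have hrow := sum_mul_sub_ge_phi (univ.filter (fun y => H.Adj w y)) (offDeg H w) D (fun y _ => hD y)
  rw [hsumcol] at hcol
  rw [hsumrow] at hrow
  -- the residues: `t + I = D m + (r + I)`, `t − I = D m + (r − I)`
  have eplus : t + I = D * m + (r + I) := by rw [ht, Nat.mul_comm D m]; ring
  have eminus : t - I = D * m + (r - I) := by rw [ht, Nat.mul_comm D m]; omega
  rw [eplus, phiD_mul_add, phiD_of_lt D (r + I) (by omega)] at hcol
  rw [eminus, phiD_mul_add, phiD_of_lt D (r - I) (by omega)] at hrow
  -- the inside edge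
  obtain ⟨x, hx, x', hx', hxx'⟩ := exists_adj_nonNbrs H w hI1
  have hnb := nbrDeg_add_nbrDeg_le_active H hfree w x x' hx hx' hxx'
  have hin := inDeg_add_inDeg_le_inside_succ H w x x' hx hx' hxx'
  rw [← hIdef] at hin
  have hcx := offDeg_eq_nbrDeg_add_inDeg H w x hx
  have hcx' := offDeg_eq_nbrDeg_add_inDeg H w x' hx'
  have hin1 : 1 ≤ inDeg H w x := by
    unfold inDeg
    exact card_pos.mpr ⟨x', mem_filter.mpr ⟨hx', hxx'⟩⟩
  have hin1' : 1 ≤ inDeg H w x' := by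
    unfold inDeg
    exact card_pos.mpr ⟨x, mem_filter.mpr ⟨hx, H.adj_symm hxx'⟩⟩
  rcases Nat.lt_or_ge (offDeg H w x + offDeg H w x') (D + (r + I)) with hcase | hcase
  · -- the column loss at the residue `r + I`
    have hmodcol : (∑ z ∈ nonNbrs H w, offDeg H w z) % D = r + I := by
      rw [hsumcol, eplus, Nat.mul_add_mod, Nat.mod_eq_of_lt (by omega)]
    have hloss := column_loss_sigma (nonNbrs H w) (offDeg H w) D (r + I) (by omega) (by omega) (fun z _ => hD z)
      x x' hx hx' (H.ne_of_adj hxx') (by omega) (by omega) (by omega) hmodcol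
    rw [phiD_of_lt D (r + I) (by omega)] at hloss
    have harith := below_arith_A D r I h1 h2 hI1 hIρ
    omega
  · -- `m + 2` active rows
    have hact : m + 2 ≤ ((univ.filter (fun y => H.Adj w y)).filter (fun y => 1 ≤ offDeg H w y)).card := by
      rw [filter_filter]
      omega
    have hrows := rows_ge_of_active (univ.filter (fun y => H.Adj w y)) (offDeg H w) D m (r - I) hD3
      (fun y _ => hD y) (by omega) (by omega) (by rw [hsumrow, eminus, Nat.mul_comm]) hact
    rw [phiD_of_lt D (r - I) (by omega)] at hrows
    have harith := below_arith_B D r I h1 h2 hI1 hIρ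
    omega

end C047

end TriangleCap

end PercRepro
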